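import Summits.CriticalPhenomena.PercolationContinuityZ3.Theorems.PercNearOneGluingNoHeavyLowerTailKNGoodGCThreeSurePath
import HarnessLib

/-!
# Moving one hair of a sure twin onto the observer: the merged hair probability `s + t − st`
# (`NoHeavyLowerTail` cell, stmt-CriticalPhenomena-4575; prover `prim-hp-2`, deletion–contraction line, gen 12)

Support file (`--supports stmt-CriticalPhenomena-4575`).  No definitions, no named facts, no sorries.
Memo: `run/shared/lean/prim/prim-hp-2/MEMO-gen12-gc-three-relays.md` §7 (phases 1–2 of the three-relay GC assembly, in one lemma).

Let the observer `x` have a SURE twin `y` (`v s(x,y) = 1`) and let `a ∉ {x, y}`; write `s = v s(x,a)`, `t = v s(y,a)`.  Then Kozma–Nitzan's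
goodness functional with explicit witness, `agood(v, x; j) = μ_v(x↔b) − μ_v(j↔b) + Σ_{W∩A=∅} μ_v(C(x)=W)·min_{a'} μ_v(a'↔b off W)`, is unchanged
if the hair `y–a` is deleted and the hair `x–a` is given the merged probability `s + t − st`:

* `KNGoodGC3.agood_moveHair_twin` — `agood(v, x; j) = agood(v[s(y,a)↦0][s(x,a)↦s+t−st], x; j)`.
Proof: both sides are affine in `t` (`agood_affine_pair_twin`, `KNGoodSeries.agood_affine_pair`), agree at `t = 0` trivially and at `t = 1`
by two applications of `agood_update_surePath` (close `s(x,a)` along `x–y–a`, then forget `s(y,a)` along `y–x–a`).  Three applications turn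
the glued two-star observer of `hGC` into a single star at `x` with hairs `x_a + y_a − x_a y_a` plus a bare sure twin, which
`KNGoodGC3.agood_kill_pendantTwin` removes.
[cite: KozmaNitzan2024, §3.2 Definition (p. 12), proof of Thm. 5 (pp. 13–14); folklore (parallel pairs through a sure link)]
-/

noncomputable section

namespace Summit.CriticalPhenomena.PercolationContinuityZ3.Theorems

open MeasureTheory Set Literature.Probability.LatticeModels Literature.Probability.Percolation
open scoped Classical BigOperators

variable {n : ℕ}

namespace KNGoodGC3

open ChampionStability KNGoodAux KNGoodHair KNGoodSeries KNGoodPortFree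

/-- The merged probability of two parallel hairs is in `[0,1]`. [folklore] -/
theorem mergeHair_mem (s t : unitInterval) : (s : ℝ) + t - s * t ∈ unitInterval := by
  have hs0 := s.2.1; have hs1 := s.2.2; have ht0 := t.2.1; have ht1 := t.2.2
  constructor
  · nlinarith [mul_nonneg hs0 (sub_nonneg.2 ht1)]
  · nlinarith [mul_nonneg (sub_nonneg.2 hs1) (sub_nonneg.2 ht1)]

/-- **Moving a hair of the sure twin onto the observer.**  `x ≠ y`, `a ∉ {x,y}`, `v s(x,y) = 1`, `s = v s(x,a)`, `t = v s(y,a)`: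
`agood(v, x; j) = agood(v[s(y,a)↦0][s(x,a)↦s+t−st], x; j)`. [cite: KozmaNitzan2024, §3.2 Definition (p. 12); folklore] -/
theorem agood_moveHair_twin (v : Sym2 (Fin n) → unitInterval) (A : Finset (Fin n)) (hA : A.Nonempty)
    (x y a j b : Fin n) (hxy : x ≠ y) (hxa : x ≠ a) (hya : y ≠ a) (hsure : v s(x, y) = 1) :
    (prodBernoulli v).real (openConn x b) - (prodBernoulli v).real (openConn j b) +
        ∑ W ∈ nullSets A, (prodBernoulli v).real (clusterIs x W) *
          A.inf' hA (fun a' => (prodBernoulli v).real (openConnIn ((↑W : Set (Fin n))ᶜ) a' b)) =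
      (prodBernoulli (Function.update (Function.update v s(y, a) 0) s(x, a)
          ⟨(v s(x, a) : ℝ) + v s(y, a) - v s(x, a) * v s(y, a), mergeHair_mem (v s(x, a)) (v s(y, a))⟩)).real (openConn x b) -
        (prodBernoulli (Function.update (Function.update v s(y, a) 0) s(x, a)
          ⟨(v s(x, a) : ℝ) + v s(y, a) - v s(x, a) * v s(y, a), mergeHair_mem (v s(x, a)) (v s(y, a))⟩)).real (openConn j b) +
        ∑ W ∈ nullSets A, (prodBernoulli (Function.update (Function.update v s(y, a) 0) s(x, a)
            ⟨(v s(x, a) : ℝ) + v s(y, a) - v s(x, a) * v s(y, a), mergeHair_mem (v s(x, a)) (v s(y, a))⟩)).real (clusterIs x W) *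
          A.inf' hA (fun a' => (prodBernoulli (Function.update (Function.update v s(y, a) 0) s(x, a)
            ⟨(v s(x, a) : ℝ) + v s(y, a) - v s(x, a) * v s(y, a), mergeHair_mem (v s(x, a)) (v s(y, a))⟩)).real
              (openConnIn ((↑W : Set (Fin n))ᶜ) a' b)) := by
  -- notation: the goodness functional of a weight function at observer `x`, witness `j`
  set ag : (Sym2 (Fin n) → unitInterval) → ℝ := fun u =>
    (prodBernoulli u).real (openConn x b) - (prodBernoulli u).real (openConn j b) +
      ∑ W ∈ nullSets A, (prodBernoulli u).real (clusterIs x W) *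
        A.inf' hA (fun a' => (prodBernoulli u).real (openConnIn ((↑W : Set (Fin n))ᶜ) a' b)) with hag
  set s : unitInterval := v s(x, a) with hs
  set t : unitInterval := v s(y, a) with ht
  set H : unitInterval := ⟨(s : ℝ) + t - s * t, mergeHair_mem s t⟩ with hH
  set ey : Sym2 (Fin n) := s(y, a) with hey
  set ex : Sym2 (Fin n) := s(x, a) with hex
  set w : Sym2 (Fin n) → unitInterval := Function.update v ey 0 with hw
  change ag v = ag (Function.update w ex H)
  have hax : a ≠ x := fun h => hxa h.symm
  have hexy : ex ≠ ey := by
    rw [hex, hey]; intro h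
    rcases Sym2.eq_iff.1 h with ⟨h1, _⟩ | ⟨h1, _⟩
    · exact hxy h1
    · exact hxa h1
  have hxy_ey : s(x, y) ≠ ey := by
    rw [hey]; intro h
    rcases Sym2.eq_iff.1 h with ⟨h1, _⟩ | ⟨h1, _⟩
    · exact hxy h1
    · exact hxa h1
  have hxy_ex : s(x, y) ≠ ex := by
    rw [hex]; intro h
    exact hya (Sym2.congr_right.1 h)
  -- affine expansions
  have L : ∀ t' : unitInterval, ag (Function.update v ey t') =
      (1 - (t' : ℝ)) * ag (Function.update v ey 0) + (t' : ℝ) * ag (Function.update v ey 1) := by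
    intro t'
    simp only [hag, hey]
    exact agood_affine_pair_twin v A hA x y a j b hxy hax hsure t'
  have R : ∀ s' : unitInterval, ag (Function.update w ex s') =
      (1 - (s' : ℝ)) * ag (Function.update w ex 0) + (s' : ℝ) * ag (Function.update w ex 1) := by
    intro s'
    simp only [hag, hex]
    exact agood_affine_pair w A hA x a j b s'
  -- left-hand side as an affine function of `t`
  have hv : v = Function.update v ey t := by rw [ht, hey, Function.update_eq_self]
  -- `t = 0` corner: `v[ey↦0] = w = w[ex↦s]`
  have h0 : ag (Function.update v ey 0) = (1 - (s : ℝ)) * ag (Function.update w ex 0) + (s : ℝ) * ag (Function.update w ex 1) := by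
    have : Function.update v ey 0 = Function.update w ex s := by
      rw [hw, hs, hex]
      have hval : Function.update v ey 0 s(x, a) = v s(x, a) := by rw [Function.update_of_ne hexy]
      rw [← hval, Function.update_eq_self]
    rw [this, R s]
  -- `t = 1` corner: `agood(v[ey↦1]) = agood(w[ex↦1])` by two sure-path moves
  have h1 : ag (Function.update v ey 1) = ag (Function.update w ex 1) := by
    -- close `ex` along `x – y – a`
    have hs1 : Function.update v ey 1 s(x, y) = 1 := by rw [Function.update_of_ne hxy_ey, hsure]
    have hs2 : Function.update v ey 1 s(y, a) = 1 := by rw [hey, Function.update_self]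
    have step1 : ∀ c : unitInterval, ag (Function.update (Function.update v ey 1) ex c) =
        ag (Function.update (Function.update v ey 1) ex 0) := by
      intro c
      simp only [hag, hex]
      exact agood_update_surePath (Function.update v ey 1) A hA hxy hya hxa hs1 hs2 x j b (Or.inl rfl) c
    have e1 : ag (Function.update v ey 1) = ag (Function.update (Function.update v ey 1) ex 1) :=
      calc ag (Function.update v ey 1)
          = ag (Function.update (Function.update v ey 1) ex (Function.update v ey 1 ex)) := by rw [Function.update_eq_self]
        _ = ag (Function.update (Function.update v ey 1) ex 0) := step1 _
        _ = ag (Function.update (Function.update v ey 1) ex 1) := (step1 1).symm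
    -- forget `ey` along `y – x – a`
    set v11 : Sym2 (Fin n) → unitInterval := Function.update (Function.update v ex 1) ey 1 with hv11
    have hcomm : Function.update (Function.update v ey 1) ex 1 = v11 := by
      rw [hv11, Function.update_comm hexy]
    have hw1 : Function.update w ex 1 = Function.update (Function.update v ex 1) ey 0 := by
      rw [hw, Function.update_comm hexy.symm]
    have hs3 : Function.update v ex 1 s(y, x) = 1 := by rw [Sym2.eq_swap, Function.update_of_ne hxy_ex, hsure]
    have hs4 : Function.update v ex 1 s(x, a) = 1 := by rw [hex, Function.update_self]
    have step2 : ∀ c : unitInterval, ag (Function.update (Function.update v ex 1) ey c) =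
        ag (Function.update (Function.update v ex 1) ey 0) := by
      intro c
      simp only [hag, hey]
      exact agood_update_surePath (Function.update v ex 1) A hA hxy.symm hxa hya hs3 hs4 x j b (Or.inr rfl) c
    rw [e1, hcomm, hv11, step2 1, ← hw1]
  -- assemble
  have hHval : ((H : unitInterval) : ℝ) = (s : ℝ) + t - s * t := rfl
  rw [hv, L t, h0, h1, R H, hHval]
  ring

end KNGoodGC3

end Summit.CriticalPhenomena.PercolationContinuityZ3.Theorems

end
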